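import Summits.BirchSwinnertonDyer.BirchSwinnertonDyer.Theorems.TwoAdicConverseBDPSelmerLowerDivisibilityAtTwoGaussContent
import HarnessLib

/-!
# Gauss PIN on ONE line over `𝒪_{ℂ_p}⟦T₁⟧⟦T₂⟧`: `p^m·G = C·h`, the RESTRICTION of `red C` to the line `T₁ = 0` non-zero, and
# `red(G|_{T₁=0}) ∣ red(C|_{T₁=0})` in `𝔽̄_p⟦T⟧` ⟹ `(C) = (G)` (crux `BDPSelmerLowerDivisibilityAtTwo`,
# stmt-BirchSwinnertonDyer-24728; route `TwoAdicConverse`, rung S3)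

Helper file `--supports stmt-BirchSwinnertonDyer-24728` (LEAD `cruxlead-stmt-BirchSwinnertonDyer-19556` g11; pen RC-556 «cofactor
localisation / Gauss pin»: «in 𝒪^ur⟦T₁,T₂⟧, U with 2-power slack ∧ 2 ∤ ch(X_Gr) (Gauss content) ⟹ G = ch·h′; h′ is a unit iff h′(0,0)
is, so two-variable EQUALITY ⟸ an ideal (in)equality on ONE line L where π_L(ch X_Gr) ≠ 0»).  THEOREMS ONLY (no definition, no named
fact, no instance, no `sorry`); any prime `p`; the algebraic core of a possible resplit «Rres ↦ R_ℓ ∧ NONDEG(ℓ)» of the line of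
record `Cruxes/BDPSelmerLowerDivisibilityAtTwo/Lines/two_variable_gv_squeeze_two.lean`, proved BEFORE the resplit decision so that
either cut can cite it.  Companion of tower-1's two-variable Gauss rigidity `TwoAdicBDPGaussContent.span_le_span_of_pow_mul_eq_of_residue`
(the RESIDUAL two-variable hypothesis `(red G) = (red C)` is replaced by data on ONE LINE).

THE LEMMA (`span_eq_span_of_pow_mul_eq_of_line_dvd`).  `A = 𝒪_{ℂ_p}⟦T₁⟧⟦T₂⟧` (nested: OUTER `T₁ = X`, inner `T₂ = C X`), `π = constantCoeff :
A → 𝒪_{ℂ_p}⟦T₂⟧` the restriction to the line `T₁ = 0` (the `κ₂`-line of an adapted pair — the variable killed by the tree's control map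
`WeierstrassCurve.XGr₂.toXAcQuot`), `red₁ = PowerSeries.map residue : 𝒪⟦T⟧ → 𝔽̄_p⟦T⟧`.  If `p^m·G = C·h` (U, slack a power of `p`),
`red₁(π C) ≠ 0` (NONDEG(ℓ): the line avoids `red C`'s divisor — it implies the two-variable `red C ≠ 0`) and `red₁(π G) ∣ red₁(π C)` (R_ℓ: the
ONE-LINE Eisenstein-direction divisibility `λ_ℓ(G) ≤ λ_ℓ(C)` in the DVR `𝔽̄_p⟦T⟧`), then `(C) = (G)` in `A`.  Proof: Gauss content for
constants (tower-1, `C_C_dvd_of_C_C_dvd_mul_of_exists_isUnit_coeff`) gives `h = p^m h₀`, `G = C h₀`; on the line `Ḡ = C̄·h̄₀` and `C̄ = Ḡ·w`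
force `h̄₀ w = 1` in the domain `𝔽̄_p⟦T⟧`, so `h₀(0,0)` has non-zero residue, i.e. `h₀ ∈ Aˣ`.  Corollaries: the `≤` form
(`span_le_span_of_pow_mul_eq_of_line_dvd`, the shape of stub S / `GaussRigidity₂`) and the symmetric line `T₂ = 0`
(`π′ = PowerSeries.map constantCoeff`, `span_eq_span_of_pow_mul_eq_of_innerLine_dvd`).
WHAT THIS DOES NOT DO: relate `red₁(π C)` to the characteristic ideal of the line's Selmer dual (the Herbrand specialisation
`ch(X/T₁X)·ch(X[T₁])⁻¹ = π(ch X)` and its `X[T₁]`-correction — seat 1's LINE-PIN objection) — that is the arithmetic half of NONDEG(ℓ)/R_ℓ.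
Nothing about any elliptic curve is asserted; O2, 19556, 19218 stay OPEN; BSD is proved for no curve.  Reference: [folklore] Gauss's
lemma / Weierstrass preparation over a rank-one valuation ring (Bosch–Güntzer–Remmert §5.1.2); pen RC-556 (STATUS l.4480).
-/

-- D-0017: single-problem summit, the namespace repeats the problem name by design.
set_option linter.dupNamespace false
set_option autoImplicit false

noncomputable section

open scoped Classical

namespace Summit.BirchSwinnertonDyer.BirchSwinnertonDyer.Theorems.TwoAdicBDPLinePin

open PowerSeries Literature.NumberTheory.EllipticCurves
  Summit.BirchSwinnertonDyer.BirchSwinnertonDyer.Theorems.TwoAdicBDPGaussContent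

variable {p : ℕ} [Fact p.Prime]

/-! ## §1 Reduction on a line detects units of `𝒪_{ℂ_p}⟦T₁⟧⟦T₂⟧` -/

/-- `constantCoeff (map f φ) = f (constantCoeff φ)`. [folklore] -/
theorem constantCoeff_map_apply {R S : Type*} [Semiring R] [Semiring S] (f : R →+* S) (φ : PowerSeries R) :
    PowerSeries.constantCoeff (PowerSeries.map f φ) = f (PowerSeries.constantCoeff φ) := by
  rw [← coeff_zero_eq_constantCoeff_apply, coeff_map, coeff_zero_eq_constantCoeff_apply]

/-- **A series `h ∈ 𝒪_{ℂ_p}⟦T₁⟧⟦T₂⟧` is a unit as soon as the reduction of its restriction to the line `T₁ = 0` is a unit of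
`𝔽̄_p⟦T⟧`** (both say: the `(0,0)`-coefficient has non-zero residue). [folklore] -/
theorem isUnit_of_isUnit_map_residue_constantCoeff {h : PowerSeries (PowerSeries (PadicComplexInt p))}
    (hu : IsUnit (PowerSeries.map (IsLocalRing.residue (PadicComplexInt p)) (PowerSeries.constantCoeff h))) :
    IsUnit h := by
  rw [PowerSeries.isUnit_iff_constantCoeff, constantCoeff_map_apply] at hu
  rw [PowerSeries.isUnit_iff_constantCoeff, PowerSeries.isUnit_iff_constantCoeff]
  exact (IsLocalRing.residue_ne_zero_iff_isUnit _).mp hu.ne_zero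

/-- The same for the line `T₂ = 0` (restriction `PowerSeries.map constantCoeff : 𝒪⟦T₁⟧⟦T₂⟧ → 𝒪⟦T₁⟧`). [folklore] -/
theorem isUnit_of_isUnit_map_residue_map_constantCoeff {h : PowerSeries (PowerSeries (PadicComplexInt p))}
    (hu : IsUnit (PowerSeries.map (IsLocalRing.residue (PadicComplexInt p))
      (PowerSeries.map (PowerSeries.constantCoeff (R := PadicComplexInt p)) h))) :
    IsUnit h := by
  rw [PowerSeries.isUnit_iff_constantCoeff, constantCoeff_map_apply, constantCoeff_map_apply] at hu
  rw [PowerSeries.isUnit_iff_constantCoeff, PowerSeries.isUnit_iff_constantCoeff]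
  exact (IsLocalRing.residue_ne_zero_iff_isUnit _).mp hu.ne_zero

/-- Non-vanishing of the reduction ON A LINE implies non-vanishing of the two-variable reduction (`μ = 0` from one line, residual
currency): `red₁(π C) ≠ 0 ⟹ red C ≠ 0`. [folklore] -/
theorem map_map_residue_ne_zero_of_line {C : PowerSeries (PowerSeries (PadicComplexInt p))}
    (hC : PowerSeries.map (IsLocalRing.residue (PadicComplexInt p)) (PowerSeries.constantCoeff C) ≠ 0) :
    PowerSeries.map (PowerSeries.map (IsLocalRing.residue (PadicComplexInt p))) C ≠ 0 := fun h0 =>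
  hC (by rw [← constantCoeff_map_apply, h0, map_zero])

/-- The same from the line `T₂ = 0`. [folklore] -/
theorem map_map_residue_ne_zero_of_innerLine {C : PowerSeries (PowerSeries (PadicComplexInt p))}
    (hC : PowerSeries.map (IsLocalRing.residue (PadicComplexInt p))
      (PowerSeries.map (PowerSeries.constantCoeff (R := PadicComplexInt p)) C) ≠ 0) :
    PowerSeries.map (PowerSeries.map (IsLocalRing.residue (PadicComplexInt p))) C ≠ 0 := by
  intro h0
  apply hC
  have h1 : PowerSeries.map (IsLocalRing.residue (PadicComplexInt p))
      (PowerSeries.map (PowerSeries.constantCoeff (R := PadicComplexInt p)) C) =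
      PowerSeries.map (PowerSeries.constantCoeff (R := IsLocalRing.ResidueField (PadicComplexInt p)))
        (PowerSeries.map (PowerSeries.map (IsLocalRing.residue (PadicComplexInt p))) C) := by
    ext n
    simp only [PowerSeries.coeff_map, constantCoeff_map_apply]
  rw [h1, h0, map_zero]

/-! ## §2 In the domain `𝔽̄_p⟦T⟧`: `Ḡ = C̄·h̄₀`, `C̄ ≠ 0`, `Ḡ ∣ C̄` ⟹ `h̄₀` is a unit -/

/-- In a domain: `G = C·h₀`, `C ≠ 0` and `G ∣ C` force `h₀` to be a unit. [folklore] -/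
theorem isUnit_of_eq_mul_of_dvd {R : Type*} [CommRing R] [IsDomain R] {C G h₀ : R} (hG : G = C * h₀) (hC : C ≠ 0)
    (hdvd : G ∣ C) : IsUnit h₀ := by
  obtain ⟨w, hw⟩ := hdvd
  have h1 : C * (h₀ * w - 1) = 0 := by
    rw [mul_sub, mul_one, sub_eq_zero, ← mul_assoc, ← hG, ← hw]
  rcases mul_eq_zero.mp h1 with h0 | h0
  · exact absurd h0 hC
  · exact isUnit_iff_exists_inv.mpr ⟨w, sub_eq_zero.mp h0⟩

/-! ## §3 The Gauss pin on the line `T₁ = 0` -/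

/-- **Gauss content step** (tower-1's master lemma, repackaged): `p^m·G = C·h` with `red C ≠ 0` ⟹ `G = C·h₀` for some `h₀`
(`h = p^m h₀`). [folklore] -/
theorem exists_eq_mul_of_pow_mul_eq_of_residue {C G h : PowerSeries (PowerSeries (PadicComplexInt p))} {m : ℕ}
    (hCh : ((p : ℕ) : PowerSeries (PowerSeries (PadicComplexInt p))) ^ m * G = C * h)
    (hC : PowerSeries.map (PowerSeries.map (IsLocalRing.residue (PadicComplexInt p))) C ≠ 0) :
    ∃ h₀ : PowerSeries (PowerSeries (PadicComplexInt p)), G = C * h₀ := by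
  have hCu : ∃ i : ℕ × ℕ, IsUnit (coeff i.2 (coeff i.1 C)) := exists_isUnit_coeff_of_map_map_residue_ne_zero hC
  have hdvd : PowerSeries.C (PowerSeries.C (((p : ℕ) : PadicComplexInt p) ^ m)) ∣ C * h :=
    ⟨G, by rw [← hCh, natCast_pow_eq_C_C]⟩
  obtain ⟨h₀, rfl⟩ := C_C_dvd_of_C_C_dvd_mul_of_exists_isUnit_coeff hCu hdvd
  refine ⟨h₀, mul_left_cancel₀ (C_C_ne_zero (pow_ne_zero m (natCast_prime_padicComplexInt_ne_zero (p := p)))) ?_⟩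
  rw [← natCast_pow_eq_C_C, hCh, natCast_pow_eq_C_C]; ring

/-- **THE GAUSS PIN on the line `T₁ = 0`.**  Over `A = 𝒪_{ℂ_p}⟦T₁⟧⟦T₂⟧` with `π = constantCoeff : A → 𝒪_{ℂ_p}⟦T₂⟧` and
`red₁ = PowerSeries.map residue`: `p^m·G = C·h`, `red₁(π C) ≠ 0` and `red₁(π G) ∣ red₁(π C)` ⟹ `(C) = (G)`.  (U with `p`-power slack +
NONDEG of the line + the one-line divisibility `λ_ℓ(G) ≤ λ_ℓ(C)` ⟹ two-variable EQUALITY.) [folklore] -/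
theorem span_eq_span_of_pow_mul_eq_of_line_dvd (C G h : PowerSeries (PowerSeries (PadicComplexInt p))) (m : ℕ)
    (hCh : ((p : ℕ) : PowerSeries (PowerSeries (PadicComplexInt p))) ^ m * G = C * h)
    (hC : PowerSeries.map (IsLocalRing.residue (PadicComplexInt p)) (PowerSeries.constantCoeff C) ≠ 0)
    (hdvd : PowerSeries.map (IsLocalRing.residue (PadicComplexInt p)) (PowerSeries.constantCoeff G) ∣
      PowerSeries.map (IsLocalRing.residue (PadicComplexInt p)) (PowerSeries.constantCoeff C)) :
    Ideal.span {C} = Ideal.span {G} := by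
  obtain ⟨h₀, hG⟩ := exists_eq_mul_of_pow_mul_eq_of_residue hCh (map_map_residue_ne_zero_of_line hC)
  -- on the line: `Ḡ = C̄ · h̄₀`
  have hline : PowerSeries.map (IsLocalRing.residue (PadicComplexInt p)) (PowerSeries.constantCoeff G) =
      PowerSeries.map (IsLocalRing.residue (PadicComplexInt p)) (PowerSeries.constantCoeff C) *
        PowerSeries.map (IsLocalRing.residue (PadicComplexInt p)) (PowerSeries.constantCoeff h₀) := by
    rw [hG, map_mul, map_mul]
  obtain ⟨u, hu⟩ := isUnit_of_isUnit_map_residue_constantCoeff (isUnit_of_eq_mul_of_dvd hline hC hdvd)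
  apply le_antisymm
  · refine Ideal.span_singleton_le_span_singleton.mpr ⟨↑u⁻¹, ?_⟩
    rw [hG, ← hu, mul_assoc, Units.mul_inv, mul_one]
  · exact Ideal.span_singleton_le_span_singleton.mpr ⟨h₀, hG⟩

/-- The `≤` form (shape of stub S / `GaussRigidity₂` with the residual equality replaced by line data): `(C) ⊆ (G)`. [folklore] -/
theorem span_le_span_of_pow_mul_eq_of_line_dvd (C G h : PowerSeries (PowerSeries (PadicComplexInt p))) (m : ℕ)
    (hCh : ((p : ℕ) : PowerSeries (PowerSeries (PadicComplexInt p))) ^ m * G = C * h)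
    (hC : PowerSeries.map (IsLocalRing.residue (PadicComplexInt p)) (PowerSeries.constantCoeff C) ≠ 0)
    (hdvd : PowerSeries.map (IsLocalRing.residue (PadicComplexInt p)) (PowerSeries.constantCoeff G) ∣
      PowerSeries.map (IsLocalRing.residue (PadicComplexInt p)) (PowerSeries.constantCoeff C)) :
    Ideal.span {C} ≤ Ideal.span {G} :=
  (span_eq_span_of_pow_mul_eq_of_line_dvd C G h m hCh hC hdvd).le

/-- `p = 2` literal form (slack `2^m`, as in the line file's `A₂`). [folklore] -/
theorem span_eq_span_of_two_pow_mul_eq_of_line_dvd (C G h : PowerSeries (PowerSeries (PadicComplexInt 2))) (m : ℕ)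
    (hCh : (2 : PowerSeries (PowerSeries (PadicComplexInt 2))) ^ m * G = C * h)
    (hC : PowerSeries.map (IsLocalRing.residue (PadicComplexInt 2)) (PowerSeries.constantCoeff C) ≠ 0)
    (hdvd : PowerSeries.map (IsLocalRing.residue (PadicComplexInt 2)) (PowerSeries.constantCoeff G) ∣
      PowerSeries.map (IsLocalRing.residue (PadicComplexInt 2)) (PowerSeries.constantCoeff C)) :
    Ideal.span {C} = Ideal.span {G} :=
  span_eq_span_of_pow_mul_eq_of_line_dvd C G h m (by rw [Nat.cast_ofNat]; exact hCh) hC hdvd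

/-! ## §4 The Gauss pin on the other line `T₂ = 0` -/

/-- **THE GAUSS PIN on the line `T₂ = 0`** (`π′ = PowerSeries.map constantCoeff : A → 𝒪_{ℂ_p}⟦T₁⟧`): `p^m·G = C·h`,
`red₁(π′ C) ≠ 0`, `red₁(π′ G) ∣ red₁(π′ C)` ⟹ `(C) = (G)`. [folklore] -/
theorem span_eq_span_of_pow_mul_eq_of_innerLine_dvd (C G h : PowerSeries (PowerSeries (PadicComplexInt p))) (m : ℕ)
    (hCh : ((p : ℕ) : PowerSeries (PowerSeries (PadicComplexInt p))) ^ m * G = C * h)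
    (hC : PowerSeries.map (IsLocalRing.residue (PadicComplexInt p))
      (PowerSeries.map (PowerSeries.constantCoeff (R := PadicComplexInt p)) C) ≠ 0)
    (hdvd : PowerSeries.map (IsLocalRing.residue (PadicComplexInt p))
        (PowerSeries.map (PowerSeries.constantCoeff (R := PadicComplexInt p)) G) ∣
      PowerSeries.map (IsLocalRing.residue (PadicComplexInt p))
        (PowerSeries.map (PowerSeries.constantCoeff (R := PadicComplexInt p)) C)) :
    Ideal.span {C} = Ideal.span {G} := by
  obtain ⟨h₀, hG⟩ := exists_eq_mul_of_pow_mul_eq_of_residue hCh (map_map_residue_ne_zero_of_innerLine hC)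
  have hline : PowerSeries.map (IsLocalRing.residue (PadicComplexInt p))
        (PowerSeries.map (PowerSeries.constantCoeff (R := PadicComplexInt p)) G) =
      PowerSeries.map (IsLocalRing.residue (PadicComplexInt p))
          (PowerSeries.map (PowerSeries.constantCoeff (R := PadicComplexInt p)) C) *
        PowerSeries.map (IsLocalRing.residue (PadicComplexInt p))
          (PowerSeries.map (PowerSeries.constantCoeff (R := PadicComplexInt p)) h₀) := by
    rw [hG, map_mul, map_mul]
  obtain ⟨u, hu⟩ := isUnit_of_isUnit_map_residue_map_constantCoeff (isUnit_of_eq_mul_of_dvd hline hC hdvd)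
  apply le_antisymm
  · refine Ideal.span_singleton_le_span_singleton.mpr ⟨↑u⁻¹, ?_⟩
    rw [hG, ← hu, mul_assoc, Units.mul_inv, mul_one]
  · exact Ideal.span_singleton_le_span_singleton.mpr ⟨h₀, hG⟩

end Summit.BirchSwinnertonDyer.BirchSwinnertonDyer.Theorems.TwoAdicBDPLinePin

end
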